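import Summits.QuantumFields.BalabanUV.T4Continuum.Spine.NE1p.DressedBirthSuppliers

/-!
# T⁴ programme, spine estimate NE1′ (node O3b/H2) — LEAF L-B: THE (w1) BINDER READ IN ROW O3.E-i′'s FIRST-ORDER CURRENCY
# (crew row S5 of the NE1′ formalisation swarm, follower of `Spine/NE1p/DressedBirthSuppliers`)

Cell `pub-balaban`, sub-cell `t4`, BINDER-OWNERS row NE1′ (owner lineage t4-ne1p-p1, skeleton `t4/skeletons/NE1p-t4-ne1p-p1.md`
v1.1 §2 leaf L-B ∕ §6 seat S5); swarm unit `b2b-balaban-t4-ne1p-formalise-leaf-05`; tree target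
`Summits/QuantumFields/BalabanUV/T4Continuum/Spine/NE1p/`; ADDITIVE — imports `Spine/NE1p/DressedBirthSuppliers` ONLY, modifies nothing.

CONTENTS.
* §1 THE (w1) BINDER READ IN ROW O3.E-i′'s CURRENCY.  The skeleton's L-B row names its supplier format: row O3.E-i′'s first-order
  birth sizes `T4FirstOrderSize.firstOrderSize_birth` — per birth scale `j`, `|s j| ≤ C₁·(g_j²R_j²)·(θ₁φ)^{K−j}`
  (`T4FirstOrderSize.SizeShape K s C₁ w r` with weight `w j = g_j²R_j²` and rate `r = θ₁φ`; `FirstOrderSize` BY NAME).  With the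
  per-family link `gen b j_b ≤ |s j_b|` (the instantiation books `s j` as the sup over the families born at `j`), a K-FREE cap on the
  scale weights `w j ≤ w̄` (where the running-coupling window enters — BY NAME through the consumer only, c6) and `0 ≤ r ≤ τ`, the
  births meet `T.BirthGen (C₁·w̄) τ` (`birthGen_of_sizeShape`); hence `BookingLeaves.hbirth` VERBATIM with the amplitude room
  `U.C·(C₁·w̄) ≤ U.A₀` (`hbirth_of_firstOrderSize`, through `DressedBirthSuppliers.hbirth_of_birthGen`).
* The ADMISSIBLE REGION of the absorption door's K-free smallness (`β₀ + A·M₀·A₀·(1−ρ′)⁻¹ ≤ A₀`, `A₀` on both sides; crew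
  XREAD C-ne1pleaf02-2 INFO-1) is typed by the crew supplier `Spine/NE1p/DressedAbsorptionWindow` (leaf-02, p212827: `fanout`,
  `fanout_lt_one_of_absorbSmall`, `absorbAmplitude`, `jointWindow`, `hbirth_of_absorbsFrom_live_cell`) — not repeated here.

HONEST FRAMING.  [folklore] kernel bookkeeping over HYPOTHESIS SHAPES; 0 sorry; 0 citations used as facts; NO `def … : Prop` minted;
nothing of Bałaban's densities or the cell's D-terms is asserted — the (w1) estimate (the four factors of `firstOrderSize_birth` for the
cell's D-terms: bonds per cube, amplitude rate, conditional-mean Lipschitz constant, deviation; row O3.E-i′, record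
`t4/T4-EST-O3Ei1.md`) REMAINS A DISPLAYED BINDER, and so does the K-free weight cap `w̄`.  Printed loci ([Balaban1989LargeFieldI]
Prop. 1 p. 194, (1.100)–(1.102) p. 201; [Balaban1988RG2Cluster] (2.20) p. 16; [Balaban1987RG1] (1.11)/(1.14) p. 262) are CONTEXT
for the binders, never hypothesis-free facts.  Headline: «L-B ⇐ the named binders», NEVER «NE1′ proved»;
NE1′ NOT PRINTED, NOT PROVED; 0 binders instantiated on Bałaban's densities; spine PROVED 0∕9 unchanged.  Rung (B)+1 on ONE finite
four-torus — NOT infinite volume, NOT a mass gap, NOT the Clay problem, NOT summit progress.  HONEST DEPENDENCY: continuum YM on T⁴ ⇐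
BetaPertH ∧ nine spine estimates (0/9 proved); BetaPertH ⇐ (D1) ∧ (D4) ∧ CAP+tail; G-an2-4 gates asym, D1 and NE2/3/4.
-/

noncomputable section

namespace Summit.QuantumFields.BalabanUV.T4Continuum.NE1p.DressedBirthSuppliers

open Finset
open scoped BigOperators
open Literature.MathematicalPhysics.QuantumFieldTheory.Balaban1983to89
open Literature.MathematicalPhysics.QuantumFieldTheory.Balaban1983to89.T4TermFormat
open Literature.MathematicalPhysics.QuantumFieldTheory.Balaban1983to89.T4TermFormat.Booking
open Literature.MathematicalPhysics.QuantumFieldTheory.Balaban1983to89.T4TrajectoryComparison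
open Summit.QuantumFields.BalabanUV.T4Continuum.T4TrajectoryDensityDressed
open Summit.QuantumFields.BalabanUV.T4Continuum.NE1p.DressedRoot

variable {Bk : T4TermFormat.Booking} {T : Trajectory Bk}

/-! ## §1 The (w1) binder in row O3.E-i′'s currency: tube-budget-shaped birth sizes feed `BirthGen` -/

/-- **BIRTH SIZES IN THE (TOB) SHAPE GIVE `BirthGen`**: if the per-scale birth sizes `s j` are booked in the tube-budget shape
`SizeShape K s C₁ w r` (`|s j| ≤ C₁·w j·r^{K−j}`, `T4FirstOrderSize` BY NAME), every family's birth generation is below its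
scale's booked size (`gen b j_b ≤ |s j_b|`), the scale weights are capped K-FREE (`w j ≤ w̄`, `0 ≤ w̄`) and the rate is below the
class's source decay (`0 ≤ r ≤ τ`), then `T.BirthGen (C₁·w̄) τ`.  Bookkeeping; the cap `w̄` is where the running-coupling window
enters — BY NAME through the consumer, nothing about it asserted here (c6). [folklore] -/
theorem birthGen_of_sizeShape {s w : ℕ → ℝ} {C₁ wbar r τ : ℝ}
    (hsize : T4FirstOrderSize.SizeShape Bk.K s C₁ w r)
    (hlink : ∀ b : Bk.Birth, T.gen b (Bk.birthScale b) ≤ |s (Bk.birthScale b)|)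
    (hw : ∀ j, j ≤ Bk.K → w j ≤ wbar) (hwbar : 0 ≤ wbar) (hC₁ : 0 ≤ C₁) (hr0 : 0 ≤ r) (hrτ : r ≤ τ) :
    T.BirthGen (C₁ * wbar) τ := by
  intro b
  have hbK : Bk.birthScale b ≤ Bk.K := Bk.birth_le b
  calc T.gen b (Bk.birthScale b) ≤ |s (Bk.birthScale b)| := hlink b
    _ ≤ C₁ * w (Bk.birthScale b) * r ^ (Bk.K - Bk.birthScale b) := hsize _ hbK
    _ ≤ C₁ * wbar * r ^ (Bk.K - Bk.birthScale b) :=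
        mul_le_mul_of_nonneg_right (mul_le_mul_of_nonneg_left (hw _ hbK) hC₁) (pow_nonneg hr0 _)
    _ ≤ C₁ * wbar * τ ^ (Bk.K - Bk.birthScale b) :=
        mul_le_mul_of_nonneg_left (pow_le_pow_left₀ hr0 hrτ _) (mul_nonneg hC₁ hwbar)

/-- **LEAF L-B FROM ROW O3.E-i′'s FIRST-ORDER SIZE FORMAT — `BookingLeaves.hbirth` VERBATIM**: first-order birth sizes
`FirstOrderSize K s C₁ θ₁ φ g R` (`|s j| ≤ C₁·g_j²R_j²·(θ₁φ)^{K−j}`, the conclusion shape of `T4FirstOrderSize.firstOrderSize_birth`,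
row O3.E-i′ (b)), the per-family link, a K-FREE cap `g_j²·R_j² ≤ w̄` on the scale weights, `0 ≤ θ₁φ ≤ U.τ`, and the amplitude room
`U.C·(C₁·w̄) ≤ U.A₀` ⟹ `hbirth` under the dressed gate (`DressedBirthSuppliers.hbirth_of_birthGen`).  «Birth sizes `Â·τ^{K−j}` at
birth» with `Â = C₁·w̄`, read in the first-order currency; the estimate itself ((w1)) REMAINS A DISPLAYED BINDER. [folklore] -/
theorem hbirth_of_firstOrderSize (U : UniformConstants) (T : Trajectory Bk) (ρ : ℕ → ℝ) (s₀ : Bk.Birth → ℕ → ℝ)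
    (S : ℕ → Bk.Birth → Finset Bk.Birth) {s g R : ℕ → ℝ} {C₁ wbar θ₁ φ : ℝ}
    (hsize : T4FirstOrderSize.FirstOrderSize Bk.K s C₁ θ₁ φ g R)
    (hlink : ∀ b : Bk.Birth, T.gen b (Bk.birthScale b) ≤ |s (Bk.birthScale b)|)
    (hw : ∀ j, j ≤ Bk.K → g j ^ 2 * R j ^ 2 ≤ wbar) (hwbar : 0 ≤ wbar) (hC₁ : 0 ≤ C₁) (hθφ0 : 0 ≤ θ₁ * φ)
    (hθφτ : θ₁ * φ ≤ U.τ) (hAhat : U.C * (C₁ * wbar) ≤ U.A₀) :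
    T.BirthsFromOld U.C ρ (twoRate U.A₀ U.ρ₁ U.τ Bk.K) (budgetGate T s₀ U.m S U.C ρ) :=
  hbirth_of_birthGen U T ρ s₀ S (birthGen_of_sizeShape hsize hlink hw hwbar hC₁ hθφ0 hθφτ) hAhat

end Summit.QuantumFields.BalabanUV.T4Continuum.NE1p.DressedBirthSuppliers

end
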